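import Literature.Probability.RandomPlanarGeometry.SAWKestenBridgeMeasureSpace
import Literature.Probability.RandomPlanarGeometry.SAWTubeBridges
import Mathlib.Probability.Independence.InfinitePi
import Mathlib.Probability.StrongLaw
import Mathlib.Probability.IdentDistrib
import HarnessLib

/-!
# Strong laws for Kesten's renewal measure: narrow bridges and the cone bound (DCH 2013, Theorem 2.5 — steps S1a/S1b)

Topic `Literature/Probability/RandomPlanarGeometry` (continues `SAWKestenRenewalMeasure.lean` — `Q^B =
Zd.renewalBridgeMeasure`, the i.i.d. law of the irreducible pieces; `ρ = Zd.infBridge`; (8.3.13)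
`Zd.renewalBridgeMeasure_breakPointCylinder` — and `SAWKestenBridgeMeasureSpace.lean`:
`Zd.measurable_infBridge_apply`).

Source and rôle. H. Duminil-Copin, A. Hammond, *Self-avoiding walk is sub-ballistic*, CMP 324 (2013),
Theorem 2.5: `E_{iSAB}(|γ|) = ∞` (the tree's named fact `Zd.DuminilCopinHammond2013_thm2_5`,
`SAWSubBallistic.lean`), proved in §4 from a law of large numbers for the blocks of Kesten's bi-infinite
bridge measure, a cone/diamond-point density argument and the "stickbreak" surgery. The lane
(«pcv-sawmu», a-p3 g4's skeleton `Sketch_DCH25.lean`, 1eb4870c97daad3f) re-organises §4 at FIXED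
LENGTH `N` under the hypothesis to be refuted,
`FiniteMeanHyp d := Summable (k ↦ k · λ_k μ^{-k})`, in five steps S1–S5; THIS FILE proves the two
probabilistic inputs S1a/S1b (the only steps that use a law of large numbers), for every `ℤ^{d+2}`:

* **S1b** `renewalBridgeMeasure_cone_tail_tendsto_zero` (= `stub_S1_cone_as` verbatim, with
  `FiniteMeanHyp` unfolded): `Q^B{∃ t, y(ρ_t) - |x(ρ_t)| < -K} → 0` as `K → ∞`;
* **S1a** `card_wide_bridges_div_pow_tendsto_zero` (= `stub_S1_narrow` verbatim, with `FiniteMeanHyp`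
  and `xDev N γ = (range (N+1)).sup (j ↦ |x(γ_j)|)` unfolded): for every `ε > 0`,
  `#{γ ∈ B_N : εN < max_{j ≤ N} |x(γ_j)|} / μ^N → 0`.

(`y` = coordinate `0`, the bridge direction; `x` = coordinate `1`.)

Mechanism (all proved here): the coordinates of `Q^B = Measure.infinitePi` are i.i.d. with law
`irrPieceLaw` (Mathlib `iIndepFun_infinitePi`, `infinitePi_map_eval`), so Etemadi's strong law
(`ProbabilityTheory.strong_law_ae_real`) applies to every integrable block statistic
(`strong_law_pieceStat`); under `FiniteMeanHyp` the block length is integrable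
(`integrable_len_of_summable`, counting pieces by length) and so is the block `x`-displacement, whose
mean vanishes by the reflection `x ↦ -x` (`reflectWalk 1`, `integral_irrPieceLaw_eq_zero_of_odd`); the
block decomposition `infBridge_blockDecomp` (`ρ(|η^[1]|+⋯+|η^[j]| + s) = Σ_{i<j} disp(η^[i]) + η^[j+1](s)`),
`1`-Lipschitz coordinates (`abs_apply_le_of_mem_saws`) and span `≥ 1` per piece give, pathwise,
`y(ρ_t) ≥ j(t)` and `|x(ρ_t)| ≤ |Σ_{i<j(t)} Δx_i| + |η^[j(t)+1]|` (`exists_block_bounds`); the a.s. forms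
`ae_exists_forall_cone`, `ae_eventually_forall_abs_x_le` follow, and the measure forms by continuity
from above (`tendsto_measure_iInter_atTop`); S1a transfers to uniform `N`-bridges through (8.3.13):
`#{β ∈ B_N : P β} μ^{-N} = Q^B(⋃_β breakCyl β) ≤ Q^B{P(ρ)}` (`card_filter_div_pow_le_measureReal`).

Printed status: steps toward a PRINTED theorem (DCH Thm 2.5) in a re-organised proof; no novelty claimed
beyond the formalisation. [cite: DuminilCopinHammond2013, Theorem 2.5 and §4]
-/

noncomputable section

open Finset MeasureTheory ProbabilityTheory Filter Topology Literature.Probability.LatticeModels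
  Literature.Probability.Percolation
open scoped BigOperators ENNReal

namespace Literature.Probability.RandomPlanarGeometry.SAW.Zd

variable {d : ℕ} [NeZero d]

/-- Any real statistic of a piece is measurable (discrete σ-algebra). [cite: MadrasSlade1993, §8.3, p. 275 (2013 reprint)] -/
theorem measurable_pieceStat (g : IrrPiece d → ℝ) : Measurable g := measurable_of_countable g

/-- The coordinates of `Q^B` are independent: block statistics `g(η^[i])` are independent.
[cite: MadrasSlade1993, §8.3, Theorem 8.3.2 (p. 275, 2013 reprint)] -/
theorem iIndepFun_pieceStat (g : IrrPiece d → ℝ) :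
    iIndepFun (fun i (φ : ℕ → IrrPiece d) => g (φ i)) (renewalBridgeMeasure d) := by
  unfold renewalBridgeMeasure
  exact iIndepFun_infinitePi (X := fun _ => g) fun _ => measurable_pieceStat g

/-- The `i`-th piece has law `irrPieceLaw`. [cite: MadrasSlade1993, §8.3, Theorem 8.3.2 (p. 275, 2013 reprint)] -/
theorem renewalBridgeMeasure_map_eval (i : ℕ) :
    (renewalBridgeMeasure d).map (fun φ : ℕ → IrrPiece d => φ i) = irrPieceLaw d := by
  unfold renewalBridgeMeasure
  exact Measure.infinitePi_map_eval _ i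

/-- Block statistics are identically distributed. [cite: MadrasSlade1993, §8.3, Theorem 8.3.2 (p. 275, 2013 reprint)] -/
theorem identDistrib_pieceStat (g : IrrPiece d → ℝ) (i j : ℕ) :
    IdentDistrib (fun φ : ℕ → IrrPiece d => g (φ i)) (fun φ => g (φ j))
      (renewalBridgeMeasure d) (renewalBridgeMeasure d) := by
  refine ⟨(measurable_pieceStat g).comp (measurable_pi_apply i) |>.aemeasurable,
    (measurable_pieceStat g).comp (measurable_pi_apply j) |>.aemeasurable, ?_⟩
  change (renewalBridgeMeasure d).map (g ∘ fun φ : ℕ → IrrPiece d => φ i) =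
    (renewalBridgeMeasure d).map (g ∘ fun φ : ℕ → IrrPiece d => φ j)
  rw [← Measure.map_map (measurable_pieceStat g) (measurable_pi_apply i),
    ← Measure.map_map (measurable_pieceStat g) (measurable_pi_apply j),
    renewalBridgeMeasure_map_eval, renewalBridgeMeasure_map_eval]

/-- The law of one block statistic, as an integral against the piece law.
[cite: MadrasSlade1993, §8.3, Theorem 8.3.2 (p. 275, 2013 reprint)] -/
theorem integral_pieceStat (g : IrrPiece d → ℝ) (i : ℕ) :
    ∫ φ, g (φ i) ∂(renewalBridgeMeasure d) = ∫ x, g x ∂(irrPieceLaw d) := by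
  rw [← renewalBridgeMeasure_map_eval (d := d) i,
    integral_map (measurable_pi_apply i).aemeasurable (measurable_pieceStat g).aestronglyMeasurable]

/-- Integrability of a block statistic transfers from the piece law.
[cite: MadrasSlade1993, §8.3, Theorem 8.3.2 (p. 275, 2013 reprint)] -/
theorem integrable_pieceStat {g : IrrPiece d → ℝ} (hg : Integrable g (irrPieceLaw d)) (i : ℕ) :
    Integrable (fun φ : ℕ → IrrPiece d => g (φ i)) (renewalBridgeMeasure d) := by
  rw [← renewalBridgeMeasure_map_eval (d := d) i] at hg
  exact hg.comp_measurable (measurable_pi_apply i)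

/-- **Etemadi's strong law for block statistics of Kesten's renewal measure**: for an integrable
statistic `g` of a piece, `n⁻¹ Σ_{i<n} g(η^[i]) → ∫ g d(irrPieceLaw)` `Q^B`-almost surely.
[cite: MadrasSlade1993, §8.3, Theorem 8.3.2 (p. 275, 2013 reprint)] -/
theorem strong_law_pieceStat {g : IrrPiece d → ℝ} (hg : Integrable g (irrPieceLaw d)) :
    ∀ᵐ φ ∂(renewalBridgeMeasure d),
      Tendsto (fun n : ℕ => (∑ i ∈ range n, g (φ i)) / n) atTop (𝓝 (∫ x, g x ∂(irrPieceLaw d))) := by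
  have h := strong_law_ae_real (μ := renewalBridgeMeasure d) (fun i (φ : ℕ → IrrPiece d) => g (φ i))
    (integrable_pieceStat hg 0)
    (fun i j hij => (iIndepFun_pieceStat g).indepFun hij)
    (fun i => identDistrib_pieceStat g i 0)
  rw [integral_pieceStat g 0] at h
  exact h

/-- The integral against the piece law is the weighted sum `Σ_φ g(φ) μ^{-|φ|}` (for integrable `g`).
[cite: MadrasSlade1993, §8.3, p. 275 (2013 reprint)] -/
theorem integral_irrPieceLaw_eq_tsum {g : IrrPiece d → ℝ} (hg : Integrable g (irrPieceLaw d)) :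
    ∫ x, g x ∂(irrPieceLaw d) = ∑' x, ((connectiveConstant d ^ x.len)⁻¹) * g x := by
  rw [integral_countable hg]
  refine tsum_congr fun x => ?_
  rw [show (irrPieceLaw d).real {x} = (connectiveConstant d ^ x.len)⁻¹ by
    rw [measureReal_def, irrPieceLaw_singleton, ENNReal.toReal_ofReal (by
      have := connectiveConstant_pos d; positivity)]]
  rw [smul_eq_mul]


/-! ### Integrability against the piece law -/

/-- A statistic `g` of a piece is integrable for the piece law as soon as `Σ_φ μ^{-|φ|} |g φ| < ∞`.
[cite: MadrasSlade1993, §8.3, p. 275 (2013 reprint)] -/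
theorem integrable_irrPieceLaw_of_summable {g : IrrPiece d → ℝ}
    (hs : Summable fun x => (connectiveConstant d ^ x.len)⁻¹ * |g x|) : Integrable g (irrPieceLaw d) := by
  refine ⟨(measurable_pieceStat g).aestronglyMeasurable, ?_⟩
  rw [hasFiniteIntegral_iff_norm, lintegral_countable']
  have : ∀ x, ENNReal.ofReal ‖g x‖ * irrPieceLaw d {x} =
      ENNReal.ofReal ((connectiveConstant d ^ x.len)⁻¹ * |g x|) := by
    intro x
    rw [irrPieceLaw_singleton, Real.norm_eq_abs, ← ENNReal.ofReal_mul (abs_nonneg _), mul_comm]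
  simp_rw [this]
  have hμ := connectiveConstant_pos d
  rw [← ENNReal.ofReal_tsum_of_nonneg (fun x => by positivity) hs]
  exact ENNReal.ofReal_lt_top

/-- Summing a function of the LENGTH of a piece against the weights: `Σ_φ μ^{-|φ|} f(|φ|)` is summable
iff `Σ_k λ_k μ^{-k} f(k)` is (for `f ≥ 0`), by counting the `λ_k` pieces of length `k`.
[cite: MadrasSlade1993, §8.3, p. 275 (2013 reprint); §4.2, eq. (4.2.4)] -/
theorem summable_weight_mul_of_len {f : ℕ → ℝ} (hf : ∀ k, 0 ≤ f k)
    (h : Summable fun k : ℕ => (irreducibleBridgeCount d k : ℝ) / connectiveConstant d ^ k * f k) :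
    Summable fun x : IrrPiece d => (connectiveConstant d ^ x.len)⁻¹ * f x.len := by
  have hμ := connectiveConstant_pos d
  rw [← (IrrPiece.equivSigma d).symm.summable_iff]
  have hcomp : ((fun x : IrrPiece d => (connectiveConstant d ^ x.len)⁻¹ * f x.len) ∘
      (IrrPiece.equivSigma d).symm) =
      fun p : (Σ k : ℕ, {η : ℕ → Site d // η ∈ irreducibleBridges d k}) =>
        (connectiveConstant d ^ p.1)⁻¹ * f p.1 := by
    funext p; rfl
  rw [hcomp]
  refine (summable_sigma_of_nonneg fun p =>
    mul_nonneg (inv_nonneg.2 (pow_nonneg hμ.le _)) (hf p.1)).2 ⟨fun k => ?_, ?_⟩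
  · exact (hasSum_fintype _).summable
  · have : ∀ k : ℕ, ∑' _η : {η : ℕ → Site d // η ∈ irreducibleBridges d k},
        (connectiveConstant d ^ k)⁻¹ * f k =
        (irreducibleBridgeCount d k : ℝ) / connectiveConstant d ^ k * f k := by
      intro k
      rw [tsum_fintype, Finset.sum_const, Finset.card_univ, Fintype.card_coe, nsmul_eq_mul,
        div_eq_mul_inv, mul_assoc]
      rfl
    simp_rw [this]
    exact h

/-- **Under the finite-mean hypothesis `Σ_k k λ_k μ^{-k} < ∞` the block length is integrable** for the
piece law. [cite: DuminilCopinHammond2013, Theorem 2.5] -/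
theorem integrable_len_of_summable
    (h : Summable fun k : ℕ => (k : ℝ) * ((irreducibleBridgeCount d k : ℝ) / connectiveConstant d ^ k)) :
    Integrable (fun x : IrrPiece d => (x.len : ℝ)) (irrPieceLaw d) := by
  refine integrable_irrPieceLaw_of_summable ?_
  have h' := summable_weight_mul_of_len (d := d) (f := fun k => (k : ℝ)) (fun k => Nat.cast_nonneg k)
    (h.congr fun k => by ring)
  exact h'.congr fun x => by rw [Nat.abs_cast]

/-! ### Coordinates along a self-avoiding walk are `1`-Lipschitz in time -/

omit [NeZero d] in
/-- Every coordinate of an `n`-step self-avoiding walk from the origin is bounded by the time: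
`|ω_s(c)| ≤ s` for `s ≤ n` (the tree's `abs_apply_le_of_adj`, for members of `saws`).
[cite: MadrasSlade1993, §1.1] -/
theorem abs_apply_le_of_mem_saws {n : ℕ} {ω : ℕ → Site d} (hω : ω ∈ saws d n) (c : Fin d)
    (s : ℕ) (hs : s ≤ n) : |ω s c| ≤ s :=
  abs_apply_le_of_adj (mem_saws.1 hω).1 (mem_saws.1 hω).2.2.1 s hs c

/-- Inside a bridge the first coordinate is nonnegative. [cite: MadrasSlade1993, Definition 1.2.4] -/
theorem apply_fst_nonneg_of_mem_bridges {n : ℕ} {ω : ℕ → Site d} (hω : ω ∈ bridges d n) :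
    ∀ s, s ≤ n → 0 ≤ ω s 0 := by
  obtain ⟨hωs, hb⟩ := mem_bridges.1 hω
  have h0 : ω 0 0 = 0 := by rw [(mem_saws.1 hωs).1]; rfl
  intro s hs
  rcases Nat.eq_zero_or_pos s with rfl | hs1
  · rw [h0]
  · have := (hb s hs1 hs).1; rw [h0] at this; exact this.le

/-- An irreducible bridge has span at least one. [cite: DuminilCopinHammond2013, §2.2] -/
theorem IrrPiece.one_le_span (x : IrrPiece d) : 1 ≤ x.walk x.len 0 := by
  obtain ⟨hωs, hb⟩ := mem_bridges.1 x.walk_mem_bridges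
  have h0 : x.walk 0 0 = 0 := by rw [x.walk_zero]; rfl
  have := (hb x.len x.one_le_len le_rfl).1
  rw [h0] at this
  omega

/-! ### The block decomposition of the infinite bridge -/

/-- The displacement (endpoint) of a piece. [cite: MadrasSlade1993, §8.3, p. 275 (2013 reprint)] -/
def IrrPiece.disp (x : IrrPiece d) : Site d := x.walk x.len

/-- The endpoint of a concatenation of pieces is the sum of the displacements.
[cite: MadrasSlade1993, §8.3, p. 275 (2013 reprint); §1.2, eq. (1.2.15)] -/
theorem piecesWalk_piecesLen : ∀ l : List (IrrPiece d),
    piecesWalk l (piecesLen l) = (l.map IrrPiece.disp).sum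
  | [] => rfl
  | x :: l => by
    rw [piecesWalk_cons, piecesLen_cons, concatWalk_apply_add _ _ (piecesWalk_zero l), piecesWalk_piecesLen l,
      List.map_cons, List.sum_cons]
    rfl

/-- `takePieces φ (j+1) = takePieces φ j ++ [φ j]`. [cite: MadrasSlade1993, §8.3, p. 275 (2013 reprint)] -/
theorem takePieces_succ (φ : ℕ → IrrPiece d) (j : ℕ) : takePieces φ (j + 1) = takePieces φ j ++ [φ j] := by
  rw [takePieces_add]
  congr 1

/-- The total length of the first `j` pieces as a `Finset` sum. [cite: MadrasSlade1993, §8.3, p. 275 (2013 reprint)] -/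
theorem piecesLen_takePieces (φ : ℕ → IrrPiece d) (j : ℕ) :
    piecesLen (takePieces φ j) = ∑ i ∈ range j, (φ i).len := by
  induction j with
  | zero => simp
  | succ j ih => rw [takePieces_succ, piecesLen_append, ih, Finset.sum_range_succ, piecesLen_cons, piecesLen_nil,
      Nat.add_zero]

/-- The endpoint of the first `j` pieces as a `Finset` sum of displacements.
[cite: MadrasSlade1993, §8.3, p. 275 (2013 reprint)] -/
theorem sum_map_disp_takePieces (φ : ℕ → IrrPiece d) (j : ℕ) :
    ((takePieces φ j).map IrrPiece.disp).sum = ∑ i ∈ range j, (φ i).disp := by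
  induction j with
  | zero => simp
  | succ j ih => rw [takePieces_succ, List.map_append, List.sum_append, ih, Finset.sum_range_succ]; simp

/-- **Block decomposition of `ρ`**: at time `(|η^[1]| + ⋯ + |η^[j]|) + s` with `s ≤ |η^[j+1]|`, the
infinite bridge sits at `(sum of the first j displacements) + η^[j+1](s)`.
[cite: MadrasSlade1993, §8.3, p. 275 (2013 reprint); DuminilCopinHammond2013, §4] -/
theorem infBridge_blockDecomp (φ : ℕ → IrrPiece d) (j : ℕ) {s : ℕ} (hs : s ≤ (φ j).len) :
    infBridge φ ((∑ i ∈ range j, (φ i).len) + s) = (∑ i ∈ range j, (φ i).disp) + (φ j).walk s := by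
  have hlen : (∑ i ∈ range j, (φ i).len) + s ≤ piecesLen (takePieces φ (j + 1)) := by
    rw [piecesLen_takePieces, Finset.sum_range_succ]; omega
  rw [infBridge_eq_piecesWalk_takePieces φ hlen, takePieces_succ, piecesWalk_append,
    ← piecesLen_takePieces, concatWalk_apply_add _ _ (piecesWalk_zero _), piecesWalk_piecesLen,
    sum_map_disp_takePieces, piecesWalk_cons, concatWalk_apply_of_le _ _ hs]

/-- **Every time lies in a block**: `t = (|η^[1]| + ⋯ + |η^[j]|) + s` with `s < |η^[j+1]|` and `j ≤ t`.
[cite: MadrasSlade1993, §8.3, proof of Theorem 8.3.2 (the time `T`); DuminilCopinHammond2013, §4] -/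
theorem exists_block (φ : ℕ → IrrPiece d) (t : ℕ) :
    ∃ j s : ℕ, s < (φ j).len ∧ t = (∑ i ∈ range j, (φ i).len) + s ∧ j ≤ t := by
  classical
  have hex : ∃ j, t < ∑ i ∈ range (j + 1), (φ i).len :=
    ⟨t, by
      have := le_piecesLen_takePieces φ (t + 1)
      rw [piecesLen_takePieces] at this
      omega⟩
  set j := Nat.find hex with hj
  have hjspec : t < ∑ i ∈ range (j + 1), (φ i).len := Nat.find_spec hex
  have hle : ∑ i ∈ range j, (φ i).len ≤ t := by
    rcases Nat.eq_zero_or_pos j with h0 | hpos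
    · rw [h0]; simp
    · have := Nat.find_min hex (show j - 1 < j by omega)
      rw [show j - 1 + 1 = j by omega] at this
      omega
  rw [Finset.sum_range_succ] at hjspec
  refine ⟨j, t - ∑ i ∈ range j, (φ i).len, by omega, by omega, ?_⟩
  have := le_piecesLen_takePieces φ j
  rw [piecesLen_takePieces] at this
  omega

/-- **Height along `ρ`**: in block `j` the first coordinate of `ρ` is at least `j` (each completed piece
has span `≥ 1`, and a bridge never dips below its start).
[cite: DuminilCopinHammond2013, §4; MadrasSlade1993, §8.3] -/
theorem le_infBridge_fst (φ : ℕ → IrrPiece d) (j : ℕ) {s : ℕ} (hs : s ≤ (φ j).len) :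
    (j : ℤ) ≤ infBridge φ ((∑ i ∈ range j, (φ i).len) + s) 0 := by
  rw [infBridge_blockDecomp φ j hs, Pi.add_apply, Finset.sum_apply]
  have h1 : (j : ℤ) ≤ ∑ i ∈ range j, (φ i).disp 0 := by
    have : ∑ _i ∈ range j, (1 : ℤ) = j := by simp
    rw [← this]
    exact Finset.sum_le_sum fun i _ => (φ i).one_le_span
  have h2 : 0 ≤ (φ j).walk s 0 := apply_fst_nonneg_of_mem_bridges (φ j).walk_mem_bridges s hs
  linarith

/-- **Horizontal position along `ρ`** (any coordinate `c ≠ 0`, in particular `x` = coordinate `1`): in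
block `j`, `|ρ_t(c)| ≤ |Σ_{i<j} disp_i(c)| + |η^[j+1]|`.
[cite: DuminilCopinHammond2013, §4; MadrasSlade1993, §8.3] -/
theorem abs_infBridge_apply_le (φ : ℕ → IrrPiece d) (j : ℕ) {s : ℕ} (hs : s ≤ (φ j).len) (c : Fin d) :
    |infBridge φ ((∑ i ∈ range j, (φ i).len) + s) c| ≤
      |∑ i ∈ range j, (φ i).disp c| + (φ j).len := by
  rw [infBridge_blockDecomp φ j hs, Pi.add_apply, Finset.sum_apply]
  have h2 : |(φ j).walk s c| ≤ s := abs_apply_le_of_mem_saws (φ j).walk_mem_saws c s hs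
  have := abs_add_le (∑ i ∈ range j, (φ i).disp c) ((φ j).walk s c)
  have hs' : (s : ℤ) ≤ (φ j).len := by exact_mod_cast hs
  linarith

/-! ### The reflection symmetry `x ↦ -x` of the piece law: `E[Δx] = 0` -/

section Reflect

variable {d' : ℕ}

/-- Reflecting the coordinates `≥ 1` maps irreducible bridges to irreducible bridges (break points only
see the first coordinate). [cite: DuminilCopinHammond2013, §2.2; MadrasSlade1993, §8.2] -/
theorem reflectWalk_mem_irreducibleBridges {n : ℕ} {ω : ℕ → Site (d' + 1)}
    (hω : ω ∈ irreducibleBridges (d' + 1) n) : reflectWalk 1 ω ∈ irreducibleBridges (d' + 1) n := by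
  obtain ⟨hb, h1, hbr, hirr⟩ := mem_irreducibleBridges.1 hω
  have h0 : ¬ 1 ≤ (0 : Fin (d' + 1)).val := by simp
  have hc : ∀ i, reflectWalk 1 ω i 0 = ω i 0 := fun i => reflectWalk_apply_of_lt ω i h0
  refine mem_irreducibleBridges.2 ⟨reflectWalk_mem_bridges le_rfl hb, h1,
    hbr.congr fun i _ => (hc i).symm, fun k hk1 hk2 hren => hirr k hk1 hk2 ?_⟩
  obtain ⟨hkn, hA, hB⟩ := hren
  exact ⟨hkn, hA.congr fun i _ => hc i, hB.congr fun i _ => hc (k + i)⟩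

/-- The reflected piece. [cite: DuminilCopinHammond2013, §2.2; MadrasSlade1993, §8.2] -/
def IrrPiece.reflect (x : IrrPiece (d' + 1)) : IrrPiece (d' + 1) :=
  ⟨x.len, reflectWalk 1 x.walk, reflectWalk_mem_irreducibleBridges x.walk_mem⟩

/-- Reflection is an involution on pieces. [cite: MadrasSlade1993, §8.2] -/
theorem IrrPiece.reflect_reflect (x : IrrPiece (d' + 1)) : x.reflect.reflect = x :=
  IrrPiece.ext rfl (reflectWalk_reflectWalk 1 x.walk)

/-- Reflection as a permutation of the pieces. [cite: MadrasSlade1993, §8.2] -/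
def IrrPiece.reflectEquiv (d' : ℕ) : IrrPiece (d' + 1) ≃ IrrPiece (d' + 1) :=
  Function.Involutive.toPerm IrrPiece.reflect IrrPiece.reflect_reflect

/-- Reflection keeps the length. [cite: MadrasSlade1993, §8.2] -/
@[simp] theorem IrrPiece.len_reflect (x : IrrPiece (d' + 1)) : x.reflect.len = x.len := rfl

/-- Reflection negates the displacement in every coordinate `c ≥ 1`. [cite: MadrasSlade1993, §8.2] -/
theorem IrrPiece.disp_reflect_of_le (x : IrrPiece (d' + 1)) {c : Fin (d' + 1)} (hc : 1 ≤ c.val) :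
    x.reflect.disp c = -x.disp c :=
  reflectWalk_apply_of_le x.walk x.len hc

/-- **`E[Δx] = 0`**: an odd statistic of a piece (one negated by the reflection) with summable weights
integrates to zero against the piece law. [cite: DuminilCopinHammond2013, §4 (symmetry of the block displacement)] -/
theorem integral_irrPieceLaw_eq_zero_of_odd {g : IrrPiece (d' + 1) → ℝ} (hg : Integrable g (irrPieceLaw (d' + 1)))
    (hodd : ∀ x, g x.reflect = -g x) : ∫ x, g x ∂(irrPieceLaw (d' + 1)) = 0 := by
  rw [integral_irrPieceLaw_eq_tsum hg]
  set F : IrrPiece (d' + 1) → ℝ := fun x => (connectiveConstant (d' + 1) ^ x.len)⁻¹ * g x with hF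
  have h1 : ∑' x, F x = ∑' x, F (IrrPiece.reflectEquiv d' x) := ((IrrPiece.reflectEquiv d').tsum_eq F).symm
  have h2 : ∀ x, F (IrrPiece.reflectEquiv d' x) = -F x := by
    intro x
    show (connectiveConstant (d' + 1) ^ x.reflect.len)⁻¹ * g x.reflect = -((connectiveConstant (d' + 1) ^ x.len)⁻¹ * g x)
    rw [IrrPiece.len_reflect, hodd]; ring
  simp_rw [h2, tsum_neg] at h1
  linarith

end Reflect


/-! ### Deterministic lemmas on sequences -/

/-- If `S_n / n → m` then the increments are `o(n)`: `(S_{n+1} - S_n)/n → 0`.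
[cite: DuminilCopinHammond2013, §4] -/
theorem tendsto_sub_div_of_tendsto_div {S : ℕ → ℝ} {m : ℝ}
    (h : Tendsto (fun n : ℕ => S n / n) atTop (𝓝 m)) :
    Tendsto (fun n : ℕ => (S (n + 1) - S n) / n) atTop (𝓝 0) := by
  have h1 : Tendsto (fun n : ℕ => S (n + 1) / ((n : ℝ) + 1)) atTop (𝓝 m) := by
    have := h.comp (tendsto_add_atTop_nat 1)
    refine this.congr fun n => ?_
    simp only [Function.comp_apply, Nat.cast_add, Nat.cast_one]
  have h2 : Tendsto (fun n : ℕ => ((n : ℝ) + 1) / n) atTop (𝓝 1) := by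
    have : Tendsto (fun n : ℕ => 1 + (n : ℝ)⁻¹) atTop (𝓝 (1 + 0)) :=
      tendsto_const_nhds.add tendsto_inv_atTop_nhds_zero_nat
    rw [add_zero] at this
    refine this.congr' ?_
    filter_upwards [eventually_ge_atTop 1] with n hn
    have hn' : (n : ℝ) ≠ 0 := by exact_mod_cast (show n ≠ 0 by omega)
    field_simp
  have h3 : Tendsto (fun n : ℕ => S (n + 1) / ((n : ℝ) + 1) * (((n : ℝ) + 1) / n) - S n / n) atTop
      (𝓝 (m * 1 - m)) := (h1.mul h2).sub h
  rw [mul_one, sub_self] at h3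
  refine h3.congr' ?_
  filter_upwards [eventually_ge_atTop 1] with n hn
  have hn' : (n : ℝ) ≠ 0 := by exact_mod_cast (show n ≠ 0 by omega)
  have hn1 : (n : ℝ) + 1 ≠ 0 := by positivity
  field_simp

/-- If `a_n ≥ 0` and `a_n / n → 0` then, uniformly, `a_j ≤ ε n` for all `j ≤ n`, eventually in `n`.
[cite: DuminilCopinHammond2013, §4] -/
theorem eventually_forall_le_mul_of_tendsto_div {a : ℕ → ℝ} (ha : ∀ n, 0 ≤ a n)
    (h : Tendsto (fun n : ℕ => a n / n) atTop (𝓝 0)) {ε : ℝ} (hε : 0 < ε) :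
    ∀ᶠ n : ℕ in atTop, ∀ j ≤ n, a j ≤ ε * n := by
  have hev : ∀ᶠ j : ℕ in atTop, a j ≤ ε * j := by
    have h1 := (Metric.tendsto_nhds.1 h) ε hε
    filter_upwards [h1, eventually_ge_atTop 1] with j hj hj1
    rw [Real.dist_eq, sub_zero, abs_lt] at hj
    have hjpos : (0 : ℝ) < j := by exact_mod_cast hj1
    have := hj.2
    rw [div_lt_iff₀ hjpos] at this
    exact this.le
  obtain ⟨J, hJ⟩ := eventually_atTop.1 hev
  set C : ℝ := ∑ j ∈ range J, a j with hC
  have hCj : ∀ j < J, a j ≤ C := fun j hj =>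
    Finset.single_le_sum (f := a) (fun i _ => ha i) (Finset.mem_range.2 hj)
  have hC0 : 0 ≤ C := Finset.sum_nonneg fun i _ => ha i
  filter_upwards [eventually_ge_atTop ⌈C / ε⌉₊] with n hn j hjn
  have hnC : C ≤ ε * n := by
    have : C / ε ≤ n := (Nat.le_ceil _).trans (by exact_mod_cast hn)
    rwa [div_le_iff₀ hε, mul_comm] at this
  rcases lt_or_ge j J with hj | hj
  · exact (hCj j hj).trans hnC
  · refine (hJ j hj).trans ?_
    have : (j : ℝ) ≤ n := by exact_mod_cast hjn
    nlinarith

/-- If `g_j / j → 1` then `g` is bounded below. [cite: DuminilCopinHammond2013, §4] -/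
theorem exists_forall_ge_neg_of_tendsto_div_one {g : ℕ → ℝ}
    (h : Tendsto (fun j : ℕ => g j / j) atTop (𝓝 1)) : ∃ K : ℝ, ∀ j, -K ≤ g j := by
  have hev : ∀ᶠ j : ℕ in atTop, 0 ≤ g j := by
    have h1 := (Metric.tendsto_nhds.1 h) (1 / 2) (by norm_num)
    filter_upwards [h1, eventually_ge_atTop 1] with j hj hj1
    rw [Real.dist_eq, abs_lt] at hj
    have hjpos : (0 : ℝ) < j := by exact_mod_cast hj1
    have : 1 / 2 < g j / j := by linarith [hj.1]
    rw [lt_div_iff₀ hjpos] at this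
    linarith
  obtain ⟨J, hJ⟩ := eventually_atTop.1 hev
  refine ⟨∑ j ∈ range J, |g j|, fun j => ?_⟩
  rcases lt_or_ge j J with hj | hj
  · have : |g j| ≤ ∑ i ∈ range J, |g i| :=
      Finset.single_le_sum (f := fun i => |g i|) (fun i _ => abs_nonneg _) (Finset.mem_range.2 hj)
    have := neg_abs_le (g j)
    linarith
  · have : 0 ≤ ∑ i ∈ range J, |g i| := Finset.sum_nonneg fun i _ => abs_nonneg _
    linarith [hJ j hj]

/-! ### Almost-sure asymptotics of the block statistics under the finite-mean hypothesis -/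

section AS

variable {d' : ℕ}

/-- The block `x`-displacement (coordinate `1` of the endpoint), as a real statistic.
[cite: DuminilCopinHammond2013, §4] -/
def IrrPiece.xDisp (x : IrrPiece (d' + 2)) : ℝ := (x.disp 1 : ℝ)

/-- `|Δx| ≤ |φ|`. [cite: DuminilCopinHammond2013, §4] -/
theorem IrrPiece.abs_xDisp_le (x : IrrPiece (d' + 2)) : |x.xDisp| ≤ x.len := by
  unfold IrrPiece.xDisp IrrPiece.disp
  have := abs_apply_le_of_mem_saws x.walk_mem_saws 1 x.len le_rfl
  exact_mod_cast this

/-- `Δx` is odd under the reflection. [cite: DuminilCopinHammond2013, §4] -/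
theorem IrrPiece.xDisp_reflect (x : IrrPiece (d' + 2)) : x.reflect.xDisp = -x.xDisp := by
  unfold IrrPiece.xDisp
  rw [IrrPiece.disp_reflect_of_le x (c := 1) (by simp)]
  push_cast
  ring

/-- Under the finite-mean hypothesis `Δx` is integrable and `E[Δx] = 0`.
[cite: DuminilCopinHammond2013, §4] -/
theorem integral_xDisp_eq_zero
    (h : Summable fun k : ℕ => (k : ℝ) * ((irreducibleBridgeCount (d' + 2) k : ℝ) / connectiveConstant (d' + 2) ^ k)) :
    Integrable (IrrPiece.xDisp (d' := d')) (irrPieceLaw (d' + 2)) ∧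
      ∫ x, IrrPiece.xDisp x ∂(irrPieceLaw (d' + 2)) = 0 := by
  have hint : Integrable (IrrPiece.xDisp (d' := d')) (irrPieceLaw (d' + 2)) :=
    (integrable_len_of_summable h).mono' (measurable_pieceStat _).aestronglyMeasurable
      (ae_of_all _ fun x => by rw [Real.norm_eq_abs]; exact x.abs_xDisp_le)
  exact ⟨hint, integral_irrPieceLaw_eq_zero_of_odd hint IrrPiece.xDisp_reflect⟩

/-- The a.s. block asymptotics: `Q^B`-almost surely `(|Σ_{i<j} Δx_i| + |η^[j+1]|)/j → 0`.
[cite: DuminilCopinHammond2013, §4 (law of large numbers for the blocks)] -/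
theorem ae_tendsto_blockDev_div
    (h : Summable fun k : ℕ => (k : ℝ) * ((irreducibleBridgeCount (d' + 2) k : ℝ) / connectiveConstant (d' + 2) ^ k)) :
    ∀ᵐ φ ∂(renewalBridgeMeasure (d' + 2)),
      Tendsto (fun j : ℕ => (|∑ i ∈ range j, (φ i).xDisp| + ((φ j).len : ℝ)) / j) atTop (𝓝 0) := by
  obtain ⟨hintx, hx0⟩ := integral_xDisp_eq_zero h
  have hintl := integrable_len_of_summable (d := d' + 2) h
  filter_upwards [strong_law_pieceStat hintx, strong_law_pieceStat hintl] with φ hx hl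
  rw [hx0] at hx
  have h1 : Tendsto (fun j : ℕ => |∑ i ∈ range j, (φ i).xDisp| / j) atTop (𝓝 0) := by
    have := hx.abs
    rw [abs_zero] at this
    refine this.congr fun j => ?_
    rw [abs_div, Nat.abs_cast]
  have h2 : Tendsto (fun j : ℕ => ((φ j).len : ℝ) / j) atTop (𝓝 0) := by
    have := tendsto_sub_div_of_tendsto_div hl
    refine this.congr fun j => ?_
    rw [Finset.sum_range_succ, add_sub_cancel_left]
  have := h1.add h2
  rw [add_zero] at this
  refine this.congr fun j => ?_
  rw [add_div]

/-- Pathwise consequence of the block decomposition: at every time `t` there is a block index `j ≤ t`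
with `y(ρ_t) ≥ j` and `|x(ρ_t)| ≤ |Σ_{i<j} Δx_i| + |η^[j+1]|`.
[cite: DuminilCopinHammond2013, §4] -/
theorem exists_block_bounds (φ : ℕ → IrrPiece (d' + 2)) (t : ℕ) :
    ∃ j ≤ t, (j : ℝ) ≤ (infBridge φ t 0 : ℝ) ∧
      |(infBridge φ t 1 : ℝ)| ≤ |∑ i ∈ range j, (φ i).xDisp| + ((φ j).len : ℝ) := by
  obtain ⟨j, s, hs, rfl, hjt⟩ := exists_block φ t
  refine ⟨j, hjt, ?_, ?_⟩
  · have := le_infBridge_fst φ j hs.le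
    exact_mod_cast this
  · have := abs_infBridge_apply_le φ j hs.le 1
    unfold IrrPiece.xDisp
    rw [← Int.cast_sum]
    exact_mod_cast this

/-- **S1b, almost-sure form**: under the finite-mean hypothesis, `Q^B`-almost surely
`inf_t (y(ρ_t) - |x(ρ_t)|) > -∞`. [cite: DuminilCopinHammond2013, §4] -/
theorem ae_exists_forall_cone
    (h : Summable fun k : ℕ => (k : ℝ) * ((irreducibleBridgeCount (d' + 2) k : ℝ) / connectiveConstant (d' + 2) ^ k)) :
    ∀ᵐ φ ∂(renewalBridgeMeasure (d' + 2)), ∃ K : ℝ, ∀ t : ℕ,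
      -K ≤ (infBridge φ t 0 : ℝ) - |(infBridge φ t 1 : ℝ)| := by
  filter_upwards [ae_tendsto_blockDev_div h] with φ hφ
  -- `g j := j - (|X_j| + len_j)` has `g j / j → 1`
  have hg : Tendsto (fun j : ℕ => ((j : ℝ) - (|∑ i ∈ range j, (φ i).xDisp| + ((φ j).len : ℝ))) / j)
      atTop (𝓝 1) := by
    have h1 : Tendsto (fun j : ℕ => 1 - (|∑ i ∈ range j, (φ i).xDisp| + ((φ j).len : ℝ)) / j) atTop
        (𝓝 (1 - 0)) := tendsto_const_nhds.sub hφ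
    rw [sub_zero] at h1
    refine h1.congr' ?_
    filter_upwards [eventually_ge_atTop 1] with j hj
    have hj' : (j : ℝ) ≠ 0 := by exact_mod_cast (show j ≠ 0 by omega)
    field_simp
  obtain ⟨K, hK⟩ := exists_forall_ge_neg_of_tendsto_div_one hg
  refine ⟨K, fun t => ?_⟩
  obtain ⟨j, -, hy, hx⟩ := exists_block_bounds φ t
  linarith [hK j]

/-- **S1a, almost-sure form**: under the finite-mean hypothesis, for every `ε > 0`, `Q^B`-almost surely,
eventually in `n`: `|x(ρ_t)| ≤ ε n` for all `t ≤ n` (the horizontal deviation is `o(n)`).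
[cite: DuminilCopinHammond2013, §4] -/
theorem ae_eventually_forall_abs_x_le
    (h : Summable fun k : ℕ => (k : ℝ) * ((irreducibleBridgeCount (d' + 2) k : ℝ) / connectiveConstant (d' + 2) ^ k))
    {ε : ℝ} (hε : 0 < ε) :
    ∀ᵐ φ ∂(renewalBridgeMeasure (d' + 2)), ∀ᶠ n : ℕ in atTop, ∀ t ≤ n,
      |(infBridge φ t 1 : ℝ)| ≤ ε * n := by
  filter_upwards [ae_tendsto_blockDev_div h] with φ hφ
  have hev := eventually_forall_le_mul_of_tendsto_div (fun j => by positivity) hφ hε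
  filter_upwards [hev] with n hn t ht
  obtain ⟨j, hjt, -, hx⟩ := exists_block_bounds φ t
  exact hx.trans (hn j (hjt.trans ht))

end AS


/-! ### S1b: the cone functional is a.s. bounded below ⇒ its lower tail vanishes -/

section S1

variable {d' : ℕ}

/-- A real functional of the position `ρ_t` is measurable in the pieces. [cite: MadrasSlade1993, §8.3] -/
theorem measurable_comp_infBridge (f : Site (d' + 2) → ℝ) (t : ℕ) :
    Measurable fun φ : ℕ → IrrPiece (d' + 2) => f (infBridge φ t) :=
  (measurable_of_countable f).comp (measurable_infBridge_apply t)

/-- **S1b (DCH-2.5 skeleton, a-p3 g4 `stub_S1_cone_as`)**: under the finite-mean hypothesis the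
`Q^B`-mass of `{∃ t, y(ρ_t) - |x(ρ_t)| < -K}` tends to `0` as `K → ∞` — the infinite bridge stays
above a translate of the south-west/south-east cone boundary. Mechanism: a.s. `y(ρ_t) - |x(ρ_t)| ≥
j(t) - |Σ_{i<j(t)} Δx_i| - |η^[j(t)+1]| → +∞` by two strong laws (block `x`-displacements have mean
`0` by reflection symmetry, block lengths have finite mean), then continuity from above.
[cite: DuminilCopinHammond2013, Theorem 2.5 and §4] -/
theorem renewalBridgeMeasure_cone_tail_tendsto_zero
    (h : Summable fun k : ℕ => (k : ℝ) *
      ((irreducibleBridgeCount (d' + 2) k : ℝ) / connectiveConstant (d' + 2) ^ k)) :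
    Tendsto (fun K : ℕ => renewalBridgeMeasure (d' + 2)
      {φ | ∃ t : ℕ, (infBridge φ t 0 : ℝ) - |(infBridge φ t 1 : ℝ)| < -(K : ℝ)}) atTop (𝓝 0) := by
  set E : ℕ → Set (ℕ → IrrPiece (d' + 2)) := fun K =>
    {φ | ∃ t : ℕ, (infBridge φ t 0 : ℝ) - |(infBridge φ t 1 : ℝ)| < -(K : ℝ)} with hE
  have hmeas : ∀ K, MeasurableSet (E K) := by
    intro K
    have : E K = ⋃ t : ℕ, {φ | (infBridge φ t 0 : ℝ) - |(infBridge φ t 1 : ℝ)| < -(K : ℝ)} := by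
      ext φ; simp [hE]
    rw [this]
    exact MeasurableSet.iUnion fun t =>
      measurableSet_lt (measurable_comp_infBridge (fun u : Site (d' + 2) => (u 0 : ℝ) - |(u 1 : ℝ)|) t)
        measurable_const
  have hanti : Antitone E := by
    intro K K' hKK' φ hφ
    obtain ⟨t, ht⟩ := hφ
    refine ⟨t, lt_of_lt_of_le ht ?_⟩
    have : (K : ℝ) ≤ K' := by exact_mod_cast hKK'
    linarith
  have hnull : renewalBridgeMeasure (d' + 2) (⋂ K, E K) = 0 := by
    refine measure_mono_null (fun φ hφ => ?_) (ae_iff.1 (ae_exists_forall_cone h))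
    simp only [Set.mem_iInter] at hφ
    change ¬ ∃ K : ℝ, ∀ t : ℕ, -K ≤ (infBridge φ t 0 : ℝ) - |(infBridge φ t 1 : ℝ)|
    rintro ⟨K, hK⟩
    obtain ⟨t, ht⟩ := hφ ⌈K⌉₊
    have h1 := hK t
    have h2 := Nat.le_ceil K
    change (infBridge φ t 0 : ℝ) - |(infBridge φ t 1 : ℝ)| < -(⌈K⌉₊ : ℝ) at ht
    linarith
  have := tendsto_measure_iInter_atTop (μ := renewalBridgeMeasure (d' + 2))
    (fun K => (hmeas K).nullMeasurableSet) hanti ⟨0, measure_ne_top _ _⟩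
  rw [hnull] at this
  exact this

/-! ### S1a: bridges are narrow, by the transfer (8.3.13) to uniform `N`-bridges -/

/-- The break-point cylinder of an `N`-step bridge (`{ρ[0,N] = β} ∩ A_N`).
[cite: MadrasSlade1993, §8.3, eq. (8.3.13) (p. 275, 2013 reprint)] -/
def breakCyl (N : ℕ) (β : ℕ → Site (d' + 2)) : Set (ℕ → IrrPiece (d' + 2)) :=
  {φ | (∃ n, piecesLen (takePieces φ n) = N) ∧ ∀ i ≤ N, infBridge φ i = β i}

/-- Break-point cylinders of distinct `N`-step bridges are disjoint. [cite: MadrasSlade1993, §8.3, eq. (8.3.13)] -/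
theorem disjoint_breakCyl {N : ℕ} {β₁ β₂ : ℕ → Site (d' + 2)} (h₁ : β₁ ∈ bridges (d' + 2) N)
    (h₂ : β₂ ∈ bridges (d' + 2) N) (hne : β₁ ≠ β₂) : Disjoint (breakCyl N β₁) (breakCyl N β₂) := by
  rw [Set.disjoint_left]
  rintro φ ⟨-, hφ₁⟩ ⟨-, hφ₂⟩
  apply hne
  funext i
  rcases le_or_gt i N with hi | hi
  · rw [← hφ₁ i hi, hφ₂ i hi]
  · rw [(mem_saws.1 (mem_bridges.1 h₁).1).2.1 i hi.le, (mem_saws.1 (mem_bridges.1 h₂).1).2.1 i hi.le,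
      ← hφ₁ N le_rfl, hφ₂ N le_rfl]

/-- Break-point cylinders are measurable, of `Q^B`-mass `μ^{-N}`. [cite: MadrasSlade1993, §8.3, eq. (8.3.13)] -/
theorem measurableSet_breakCyl {N : ℕ} {β : ℕ → Site (d' + 2)} (hβ : β ∈ bridges (d' + 2) N) :
    MeasurableSet (breakCyl N β) := by
  obtain ⟨l, hl, rfl⟩ := exists_pieces_of_mem_bridges N hβ
  unfold breakCyl
  rw [breakPointCylinder_eq_pieceBox hl]
  exact measurableSet_pieceBox l

/-- **The transfer (8.3.13) for counting**: for any property `P` of walks which only depends on the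
values up to time `N`, `#{β ∈ B_N : P β} · μ^{-N} = Q^B(⋃_{β} breakCyl β) ≤ Q^B{P(ρ)}`; here in the form
needed for S1a. [cite: MadrasSlade1993, §8.3, eq. (8.3.13) (p. 275, 2013 reprint)] -/
theorem card_filter_div_pow_le_measureReal {N : ℕ} (P : (ℕ → Site (d' + 2)) → Prop) [DecidablePred P]
    {A : Set (ℕ → IrrPiece (d' + 2))}
    (hPA : ∀ β ∈ bridges (d' + 2) N, P β → breakCyl N β ⊆ A) :
    (#((bridges (d' + 2) N).filter P) : ℝ) / connectiveConstant (d' + 2) ^ N ≤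
      (renewalBridgeMeasure (d' + 2) A).toReal := by
  classical
  have hμ := connectiveConstant_pos (d' + 2)
  set S := (bridges (d' + 2) N).filter P with hS
  have hSb : ∀ β ∈ S, β ∈ bridges (d' + 2) N := fun β hβ => (Finset.mem_filter.1 hβ).1
  have hU : renewalBridgeMeasure (d' + 2) (⋃ β ∈ S, breakCyl N β) =
      (#S : ℝ≥0∞) * ENNReal.ofReal ((connectiveConstant (d' + 2) ^ N)⁻¹) := by
    rw [measure_biUnion_finset (fun β₁ h₁ β₂ h₂ hne => disjoint_breakCyl (hSb β₁ h₁) (hSb β₂ h₂) hne)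
      (fun β hβ => measurableSet_breakCyl (hSb β hβ))]
    have hterm : ∀ β ∈ S, renewalBridgeMeasure (d' + 2) (breakCyl N β) =
        ENNReal.ofReal ((connectiveConstant (d' + 2) ^ N)⁻¹) := fun β hβ =>
      renewalBridgeMeasure_breakPointCylinder (hSb β hβ)
    rw [Finset.sum_congr rfl hterm, Finset.sum_const, nsmul_eq_mul]
  have hsub : (⋃ β ∈ S, breakCyl N β) ⊆ A := by
    intro φ hφ
    simp only [Set.mem_iUnion] at hφ
    obtain ⟨β, hβ, hφ⟩ := hφ
    exact hPA β (hSb β hβ) (Finset.mem_filter.1 hβ).2 hφ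
  have hle := measure_mono (μ := renewalBridgeMeasure (d' + 2)) hsub
  rw [hU] at hle
  have hfin : renewalBridgeMeasure (d' + 2) A ≠ ⊤ := measure_ne_top _ _
  have := (ENNReal.toReal_le_toReal (by
    exact ENNReal.mul_ne_top (ENNReal.natCast_ne_top _) ENNReal.ofReal_ne_top) hfin).2 hle
  rw [ENNReal.toReal_mul, ENNReal.toReal_natCast, ENNReal.toReal_ofReal (by positivity)] at this
  rw [div_eq_mul_inv]
  exact this

/-- **S1a (DCH-2.5 skeleton, a-p3 g4 `stub_S1_narrow`)**: under the finite-mean hypothesis bridges are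
NARROW — for every `ε > 0`, `#{γ ∈ B_N : max_{j ≤ N} |x(γ_j)| > εN} = o(μ^N)`. Mechanism: (8.3.13)
transfers the count to `Q^B{ρ(N) break point, deviation > εN} ≤ Q^B{∃ n ≥ N, ∃ t ≤ n, |x(ρ_t)| > εn}`,
which decreases to a `Q^B`-null set by the a.s. block asymptotics. [cite: DuminilCopinHammond2013, Theorem 2.5 and §4] -/
theorem card_wide_bridges_div_pow_tendsto_zero
    (h : Summable fun k : ℕ => (k : ℝ) *
      ((irreducibleBridgeCount (d' + 2) k : ℝ) / connectiveConstant (d' + 2) ^ k))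
    {ε : ℝ} (hε : 0 < ε) :
    Tendsto (fun N : ℕ => (#((bridges (d' + 2) N).filter fun γ =>
        ε * N < (((range (N + 1)).sup fun j => (γ j 1).natAbs : ℕ) : ℝ)) : ℝ) /
      connectiveConstant (d' + 2) ^ N) atTop (𝓝 0) := by
  classical
  have hμ := connectiveConstant_pos (d' + 2)
  -- the decreasing events `F N = {∃ n ≥ N, ∃ t ≤ n, ε n < |x(ρ_t)|}`
  set F : ℕ → Set (ℕ → IrrPiece (d' + 2)) := fun N =>
    {φ | ∃ n, N ≤ n ∧ ∃ t, t ≤ n ∧ ε * n < |(infBridge φ t 1 : ℝ)|} with hF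
  have hmeas : ∀ N, MeasurableSet (F N) := by
    intro N
    have : F N = ⋃ n : ℕ, ⋃ t : ℕ, {φ | N ≤ n ∧ t ≤ n ∧ ε * n < |(infBridge φ t 1 : ℝ)|} := by
      ext φ; simp only [hF, Set.mem_setOf_eq, Set.mem_iUnion]
      constructor
      · rintro ⟨n, hn, t, ht, hx⟩; exact ⟨n, t, hn, ht, hx⟩
      · rintro ⟨n, t, hn, ht, hx⟩; exact ⟨n, hn, t, ht, hx⟩
    rw [this]
    refine MeasurableSet.iUnion fun n => MeasurableSet.iUnion fun t => ?_
    by_cases hn : N ≤ n ∧ t ≤ n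
    · have : {φ : ℕ → IrrPiece (d' + 2) | N ≤ n ∧ t ≤ n ∧ ε * n < |(infBridge φ t 1 : ℝ)|} =
          {φ | ε * n < |(infBridge φ t 1 : ℝ)|} := by
        ext φ; simp [hn.1, hn.2]
      rw [this]
      exact measurableSet_lt measurable_const
        (measurable_comp_infBridge (fun u : Site (d' + 2) => |(u 1 : ℝ)|) t)
    · have : {φ : ℕ → IrrPiece (d' + 2) | N ≤ n ∧ t ≤ n ∧ ε * n < |(infBridge φ t 1 : ℝ)|} = ∅ := by
        ext φ; simp only [Set.mem_setOf_eq, Set.mem_empty_iff_false, iff_false]; tauto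
      rw [this]; exact MeasurableSet.empty
  have hanti : Antitone F := by
    intro N N' hNN' φ hφ
    obtain ⟨n, hn, t, ht, hx⟩ := hφ
    exact ⟨n, hNN'.trans hn, t, ht, hx⟩
  have hnull : renewalBridgeMeasure (d' + 2) (⋂ N, F N) = 0 := by
    refine measure_mono_null (fun φ hφ => ?_) (ae_iff.1 (ae_eventually_forall_abs_x_le h hε))
    simp only [Set.mem_iInter] at hφ
    change ¬ ∀ᶠ n : ℕ in atTop, ∀ t ≤ n, |(infBridge φ t 1 : ℝ)| ≤ ε * n
    intro hev
    obtain ⟨N₀, hN₀⟩ := eventually_atTop.1 hev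
    obtain ⟨n, hn, t, ht, hx⟩ := hφ N₀
    have := hN₀ n hn t ht
    linarith
  have hlim : Tendsto (fun N => renewalBridgeMeasure (d' + 2) (F N)) atTop (𝓝 0) := by
    have := tendsto_measure_iInter_atTop (μ := renewalBridgeMeasure (d' + 2))
      (fun N => (hmeas N).nullMeasurableSet) hanti ⟨0, measure_ne_top _ _⟩
    rw [hnull] at this
    exact this
  have hlimR : Tendsto (fun N => (renewalBridgeMeasure (d' + 2) (F N)).toReal) atTop (𝓝 0) := by
    have := (ENNReal.tendsto_toReal ENNReal.zero_ne_top).comp hlim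
    rwa [ENNReal.toReal_zero] at this
  -- the transfer: count/μ^N ≤ Q^B(F N)
  have hle : ∀ N : ℕ, (#((bridges (d' + 2) N).filter fun γ =>
        ε * N < (((range (N + 1)).sup fun j => (γ j 1).natAbs : ℕ) : ℝ)) : ℝ) /
      connectiveConstant (d' + 2) ^ N ≤ (renewalBridgeMeasure (d' + 2) (F N)).toReal := by
    intro N
    refine card_filter_div_pow_le_measureReal _ fun β hβ hP φ hφ => ?_
    obtain ⟨-, hagree⟩ := hφ
    -- the sup is attained at some `j₀ ≤ N`
    obtain ⟨j₀, hj₀, hsup⟩ := Finset.exists_mem_eq_sup (range (N + 1)) ⟨0, by simp⟩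
      (fun j => (β j 1).natAbs)
    rw [hsup] at hP
    have hj₀N : j₀ ≤ N := by have := Finset.mem_range.1 hj₀; omega
    refine ⟨N, le_rfl, j₀, hj₀N, ?_⟩
    rw [hagree j₀ hj₀N]
    have : (((β j₀ 1).natAbs : ℕ) : ℝ) = |(β j₀ 1 : ℝ)| := by
      rw [Nat.cast_natAbs, Int.cast_abs]
    rwa [this] at hP
  exact tendsto_of_tendsto_of_tendsto_of_le_of_le tendsto_const_nhds hlimR
    (fun N => by positivity) hle

end S1

end Literature.Probability.RandomPlanarGeometry.SAW.Zd

end
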